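import Summits.HodgeConjecture.HodgeConjecture.Theorems.F0LD1ThetaArchLadderOfBox
import Literature.NumberTheory.GelbartRogawski1991.DoubledWeilRepresentationArchPlaceBoostBox
import Literature.NumberTheory.GelbartRogawski1991.ArchLocalUnitarySurjectiveBoost
import Literature.NumberTheory.GelbartRogawski1991.DoubledWeilRepresentationArchVacuumUndoubling
import Literature.RepresentationTheory.KonnoKonno2007.JunctionHyperbolicReindex
import HarnessLib

/-!
# (Gα-C∞) THE BRICK `ArchLadder` HOLDS (line LD1 of crux HLiu418; LD1-plan (g2) DEALS #9-bis; owner A-p16 (g35))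

Cell hodgecm-mathlib, floor 0; namespace `Summit.HodgeConjecture.HodgeConjecture.Cruxes.HLiu418.F0LD1ThetaArchLadder` (the brick's home namespace, second file);
`--supports stmt-HodgeConjecture-24832 --as helper`.  ONE THEOREM, no definition, no instance, no notation, no `sorry`.

**`archLadder_holds : F0LD1ThetaDichotomyOfBricks.ArchLadder`** — inside one `U(W)_ι`-type the archimedean Hermite ladder of theta classes is transitive in every closed
`U(H)(𝔸)`-invariant subspace of `L²([U(H)])`.  Proof = ★ `F0LD1ThetaArchLadderOfBox.archLadder_of_boxMoves` (A-p16 p851265: the definite places by the compact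
steps ★ P1∕P1⁻∕P2c, the wrong types by ★ P3 (A-p12), the combinatorics by ★ P5 (LD1-p01 + A-p16), the signs by ★ σ (A-p12), the class side of the ι-place by ★
A-p13's `F0LD1ThetaArchBoxStep`) applied to the LOCAL BOX MOVES at the place of `ι`, assembled here from ★ inputs only: the boost element `u_t ∈ U(σ diag dV)(ℂ)`
(★ A-p13 `exists_archLocal_entries_eq_boost`, p851288), Folland's section at `k_{v₀,u_t}` read in the doubled model as the relabelled junction boost with a non-zero
scalar (★ LD1-p02 `carrierConjEquiv_frameD_sectionD_archKPlace_of_boost` p851271, ★ `vac_weilHomV_hypV_div_vacCoeffS_hypOp_ne_zero` p851063), and the junction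
Hermite ladder «some boost moves `h_β` onto `h_{β ± (e_{kp} + e_{km})}` with non-zero coefficient» (★ LD1-p02 `exists_piCoeff_add∕sub_reindex_hypOp_hermitePi_ne_zero`
p851122 with ★ `archIdx_eq_idxP_iff`∕`archIdx_eq_idxQ_iff` p851258) [KonnoKonno2007, Thm. 5.4], [KashiwaraVergne1978, §6].  With this the leaf's
`stub_brick_archLadder` folds by name and (Gα) `ThetaDichotomy₂`, the letter (I′) and char-rigidity close by import (★ `thetaDichotomy₂_of_localBricks`).
Nothing printed is discharged; HC_CM is proved only modulo the 7 printed citations (2 remaining: hLiu418 = stmt-HodgeConjecture-24832, h413 =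
stmt-HodgeConjecture-24833) until rung 0 closes; count-neutral.

References (prose locators): Kashiwara–Vergne 1978 §6 (6.3), §7 (7.2); Howe 1989 §3; Konno–Konno 2007 §3.1, Thm. 5.4; Folland 1989 §1.7, §4.4 Thm. (4.37), Ch. 4 §5.
-/

set_option autoImplicit false
set_option linter.dupNamespace false

noncomputable section

open NumberField NumberField.InfinitePlace
open scoped Matrix Kronecker ComplexOrder Classical ComplexConjugate
open Literature.NumberTheory.Automorphic Literature.NumberTheory.Automorphic.UnitaryGroup
open Literature.NumberTheory.Automorphic.Liu2021
open Literature.NumberTheory.Automorphic.Liu2021.Def411WeilCarriers Literature.NumberTheory.Automorphic.Liu2021.Def411WeilCarriersDoubling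
open Literature.NumberTheory.GelbartRogawski1991 Literature.NumberTheory.GelbartRogawski1991.UnitaryDualPair
open Literature.NumberTheory.GelbartRogawski1991.GRConstruction
open Literature.NumberTheory.Weil1964 Literature.NumberTheory.Weil1964.MpS Literature.NumberTheory.Weil1964.UnitaryWeil
open Literature.RepresentationTheory.KonnoKonno2007 Literature.RepresentationTheory.KonnoKonno2007.RealDualPair
open Literature.Analysis.SegalBargmann Literature.RepresentationTheory.HeisenbergGroup
open Summit.HodgeConjecture.HodgeConjecture.Cruxes.HLiu418.F0LD1ThetaDichotomyOfBricks
open Summit.HodgeConjecture.HodgeConjecture.Cruxes.HLiu418.F0LD1ThetaArchLadderOfBox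

namespace Summit.HodgeConjecture.HodgeConjecture.Cruxes.HLiu418.F0LD1ThetaArchLadder

set_option maxHeartbeats 1600000 in
/-- **THE BRICK (Gα-C∞) `ArchLadder` HOLDS**: inside one `U(W)_ι`-type the archimedean Hermite ladder of theta classes is transitive in every closed `U(H)(𝔸)`-invariant
subspace of `L²([U(H)])` — ★ `archLadder_of_boxMoves` on the local box moves of the boost at the place of `ι`. [cite: KashiwaraVergne1978, §6 (6.3), §7 (7.2)]
[cite: Howe1989, §3] [cite: KonnoKonno2007, Thm. 5.4] [cite: Folland1989, §4.4 Thm. (4.37), Ch. 4 §5] -/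
theorem archLadder_holds : ArchLadder := by
  refine archLadder_of_boxMoves ?_
  intro L _ _ _ n' e₁ dV hdV hdV0 a' v₀ kp km hkp hkm β
  have hk : kp ≠ km := fun h => hkm (h ▸ hkp)
  -- the signs on the first copy of the doubled datum
  have Hp : 0 < signVec (cmPlaceOver L) (entryD L e₁ dV hdV (lineW L (TW (Fp L) a')) (complexConj_lineW L (TW (Fp L) a'))) (imagUnit L) v₀ ((e₂ (n := n')) (Sum.inl kp)) := by
    rw [signVec_entryD_inl]; exact hkp
  have Hm : ¬ 0 < signVec (cmPlaceOver L) (entryD L e₁ dV hdV (lineW L (TW (Fp L) a')) (complexConj_lineW L (TW (Fp L) a'))) (imagUnit L) v₀ ((e₂ (n := n')) (Sum.inl km)) := by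
    rw [signVec_entryD_inl]; exact hkm
  -- the two junction indices of the place of `ι` in the coordinates of the scaled Folland frame
  have hP : (archIdx L n' (cmPlaceOver L) (cmGramEntry L e₁ dV hdV (lineW L (TW (Fp L) a')) (complexConj_lineW L (TW (Fp L) a'))) (δ := imagUnit L)).symm (idxP Unit Empty (⟨v₀, ⟨kp, hkp⟩⟩ : Σ w : {v : InfinitePlace (↥(maximalRealSubfield L)) // v.IsReal}, PosIdx (signVec (cmPlaceOver L) (cmGramEntry L e₁ dV hdV (lineW L (TW (Fp L) a')) (complexConj_lineW L (TW (Fp L) a'))) (imagUnit L) w)) default) = (kp, v₀) :=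
    (Equiv.symm_apply_eq _).2
      ((archIdx_eq_idxP_iff L n' (cmPlaceOver L) (cmGramEntry L e₁ dV hdV (lineW L (TW (Fp L) a')) (complexConj_lineW L (TW (Fp L) a')))
        kp v₀ v₀ kp hkp).2 ⟨rfl, rfl⟩).symm
  have hQ : (archIdx L n' (cmPlaceOver L) (cmGramEntry L e₁ dV hdV (lineW L (TW (Fp L) a')) (complexConj_lineW L (TW (Fp L) a'))) (δ := imagUnit L)).symm (idxQ Unit Empty (⟨v₀, ⟨km, hkm⟩⟩ : Σ w : {v : InfinitePlace (↥(maximalRealSubfield L)) // v.IsReal}, NegIdx (signVec (cmPlaceOver L) (cmGramEntry L e₁ dV hdV (lineW L (TW (Fp L) a')) (complexConj_lineW L (TW (Fp L) a'))) (imagUnit L) w)) default) = (km, v₀) :=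
    (Equiv.symm_apply_eq _).2
      ((archIdx_eq_idxQ_iff L n' (cmPlaceOver L) (cmGramEntry L e₁ dV hdV (lineW L (TW (Fp L) a')) (complexConj_lineW L (TW (Fp L) a')))
        km v₀ v₀ km hkm).2 ⟨rfl, rfl⟩).symm
  refine ⟨?_, fun h1 h2 => ?_⟩
  · -- UP: some boost moves `h_β` onto `h_{β + e_kp + e_km}`
    obtain ⟨t, ht⟩ := exists_piCoeff_add_reindex_hypOp_hermitePi_ne_zero Unit Empty (⟨v₀, ⟨kp, hkp⟩⟩ : Σ w : {v : InfinitePlace (↥(maximalRealSubfield L)) // v.IsReal}, PosIdx (signVec (cmPlaceOver L) (cmGramEntry L e₁ dV hdV (lineW L (TW (Fp L) a')) (complexConj_lineW L (TW (Fp L) a'))) (imagUnit L) w)) (⟨v₀, ⟨km, hkm⟩⟩ : Σ w : {v : InfinitePlace (↥(maximalRealSubfield L)) // v.IsReal}, NegIdx (signVec (cmPlaceOver L) (cmGramEntry L e₁ dV hdV (lineW L (TW (Fp L) a')) (complexConj_lineW L (TW (Fp L) a'))) (imagUnit L) w)) (archIdx L n' (cmPlaceOver L) (cmGramEntry L e₁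 dV hdV (lineW L (TW (Fp L) a')) (complexConj_lineW L (TW (Fp L) a'))) (δ := imagUnit L)) β
    rw [hP, hQ] at ht
    obtain ⟨u, hu⟩ := exists_archLocal_entries_eq_boost L e₁ dV hdV hdV0 (lineW L (TW (Fp L) a')) (complexConj_lineW L (TW (Fp L) a')) (lineW_ne_zero L (TW (Fp L) a') (isUnit_det_TW (Fp L) a')) v₀ kp km hk hkp hkm t
    refine ⟨u, _, _, ?_, carrierConjEquiv_frameD_sectionD_archKPlace_of_boost L e₁ dV hdV (lineW L (TW (Fp L) a')) (complexConj_lineW L (TW (Fp L) a')) v₀ hdV0 (lineW_ne_zero L (TW (Fp L) a') (isUnit_det_TW (Fp L) a')) u t kp km hkp hkm Hp Hm hu β 0, ?_⟩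
    · exact vac_weilHomV_hypV_div_vacCoeffS_hypOp_ne_zero _ _ _ _ t
    · rw [carrierConjEquiv_apply, ContinuousLinearEquiv.apply_symm_apply, schwartzTransport_follandHermite, MpS.reindexEquiv_apply, hypOpEquiv_apply]
      exact ht
  · -- DOWN (`β_kp, β_km ≥ 1`): some boost moves `h_β` onto `h_{β − e_kp − e_km}`
    obtain ⟨t, ht⟩ := exists_piCoeff_sub_reindex_hypOp_hermitePi_ne_zero Unit Empty (⟨v₀, ⟨kp, hkp⟩⟩ : Σ w : {v : InfinitePlace (↥(maximalRealSubfield L)) // v.IsReal}, PosIdx (signVec (cmPlaceOver L) (cmGramEntry L e₁ dV hdV (lineW L (TW (Fp L) a')) (complexConj_lineW L (TW (Fp L) a'))) (imagUnit L) w)) (⟨v₀, ⟨km, hkm⟩⟩ : Σ w : {v : InfinitePlace (↥(maximalRealSubfield L)) // v.IsReal}, NegIdx (signVec (cmPlaceOver L) (cmGramEntry L e₁ dV hdV (lineW L (TW (Fp L) a')) (complexConj_lineW L (TW (Fp L) a'))) (imagUnit L) w)) (archIdx L n' (cmPlaceOver L) (cmGramEntry L e₁ dV hdV (lineW L (TW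 (Fp L) a')) (complexConj_lineW L (TW (Fp L) a'))) (δ := imagUnit L)) β
      (by rw [hP]; exact Nat.one_le_of_lt h1) (by rw [hQ]; exact Nat.one_le_of_lt h2)
    rw [hP, hQ] at ht
    obtain ⟨u, hu⟩ := exists_archLocal_entries_eq_boost L e₁ dV hdV hdV0 (lineW L (TW (Fp L) a')) (complexConj_lineW L (TW (Fp L) a')) (lineW_ne_zero L (TW (Fp L) a') (isUnit_det_TW (Fp L) a')) v₀ kp km hk hkp hkm t
    refine ⟨u, _, _, ?_, carrierConjEquiv_frameD_sectionD_archKPlace_of_boost L e₁ dV hdV (lineW L (TW (Fp L) a')) (complexConj_lineW L (TW (Fp L) a')) v₀ hdV0 (lineW_ne_zero L (TW (Fp L) a') (isUnit_det_TW (Fp L) a')) u t kp km hkp hkm Hp Hm hu β 0, ?_⟩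
    · exact vac_weilHomV_hypV_div_vacCoeffS_hypOp_ne_zero _ _ _ _ t
    · rw [carrierConjEquiv_apply, ContinuousLinearEquiv.apply_symm_apply, schwartzTransport_follandHermite, MpS.reindexEquiv_apply, hypOpEquiv_apply]
      exact ht

end Summit.HodgeConjecture.HodgeConjecture.Cruxes.HLiu418.F0LD1ThetaArchLadder

end
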